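import Mathlib
import HarnessLib

/-!
# Saddle box lower bound, part 1: Gaussian pieces and the five-piece box estimate

Helper file (part 1 of 2) for route `TcThermcert1`, crux `ThermalStiffnessCeilingU8b10_le_1o8`
(item `stmt-Ventures-26381`), line `Cruxes/ThermalStiffnessCeilingU8b10_le_1o8/Lines/zerofree_corridor.lean`,
registered stub `stub_largePowersSaddle2D` (the hot-end fugacity-torus saddle).  Line v8 (§L) splits that stub
into (K3a) a LOCAL BOX LOWER BOUND — proved in part 2 (`TcThermcert1SaddleBoxLowerBound.lean`,
`box_integral_re_lower_bound`) — and (K3b) the saddle geometry on the fugacity torus (`stub_saddleGeometry`),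
with the composition proved in the line file.  This part collects the model-free real analysis:

* §1 one-dimensional Gaussian pieces: the tail `∫_δ^ρ e^{−c u²} du ≤ e^{−c δ²}/(2 c δ)` (and its mirror image
  on `[−ρ, −δ]`), the whole-line bound `∫_a^b e^{−c u²} du ≤ √(π/c)`, and the centre bound
  `∫_{−δ}^{δ} e^{−q v²} dv ≥ 2 e^{−S}/n` for `q/n² ≤ S`, `1/n ≤ δ`;
* §2 `Re exp z ≥ ½ exp (Re z)` for `|Im z| ≤ 1` (`cos y ≥ 1 − y²/2`);
* §3 the abstract five-piece box estimate `re_box_integral_ge`: for a jointly continuous `f : ℝ → ℝ → ℂ` with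
  `‖f‖ ≤ e^{−p u²} e^{−p v²}` on the box `|u|, |v| ≤ ρ` and `Re f ≥ ½ e^{−q u²} e^{−q v²}` on the centre square
  `|u|, |v| ≤ δ`, `Re ∫_{−ρ}^{ρ}∫_{−ρ}^{ρ} f ≥ B²/2 − 4 δ E − 2 J E` (`B` the centre Gaussian, `E` the tail,
  `J = √(π/p)`).

[folklore] Laplace-method bookkeeping (e.g. de Bruijn, *Asymptotic Methods in Analysis*, ch. 4); constants
not optimised.  No definitions; all statements proved; no `sorry`.
-/

noncomputable section

open MeasureTheory Set

namespace Summit.Ventures.CertifiedManyBodySolver.Theorems.TcThermcert1.ZeroFreeCorridor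

/-! ## §1 One-dimensional Gaussian pieces -/

/-- Gaussian tail on `[δ, ρ]` (`0 < δ ≤ ρ`, `0 < c`): `∫_δ^ρ e^{−c u²} du ≤ e^{−c δ²}/(2 c δ)`, by comparison
with `(u/δ) e^{−c u²}`, which has the primitive `−e^{−c u²}/(2 c δ)`. -/
theorem integral_exp_neg_mul_sq_tail_le {c δ ρ : ℝ} (hc : 0 < c) (hδ : 0 < δ) (hδρ : δ ≤ ρ) :
    ∫ u in δ..ρ, Real.exp (-c * u ^ 2) ≤ Real.exp (-c * δ ^ 2) / (2 * c * δ) := by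
  have hderiv : ∀ u ∈ uIcc δ ρ,
      HasDerivAt (fun u => -Real.exp (-c * u ^ 2) / (2 * c * δ)) (u / δ * Real.exp (-c * u ^ 2)) u := by
    intro u _
    have h1 : HasDerivAt (fun u : ℝ => -c * u ^ 2) (-c * (2 * u)) u := by
      simpa using (hasDerivAt_pow 2 u).const_mul (-c)
    have h2 : HasDerivAt (fun u : ℝ => -Real.exp (-c * u ^ 2) / (2 * c * δ))
        (-(Real.exp (-c * u ^ 2) * (-c * (2 * u))) / (2 * c * δ)) u :=
      (h1.exp.neg).div_const (2 * c * δ)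
    refine h2.congr_deriv ?_
    rw [div_eq_iff (by positivity), div_mul_eq_mul_div, div_mul_eq_mul_div, eq_div_iff hδ.ne']
    ring
  have hcont : Continuous fun u : ℝ => Real.exp (-c * u ^ 2) := by fun_prop
  have hgi : IntervalIntegrable (fun u : ℝ => u / δ * Real.exp (-c * u ^ 2)) volume δ ρ :=
    ((continuous_id.div_const δ).mul hcont).intervalIntegrable _ _
  calc ∫ u in δ..ρ, Real.exp (-c * u ^ 2)
      ≤ ∫ u in δ..ρ, u / δ * Real.exp (-c * u ^ 2) := by
        refine intervalIntegral.integral_mono_on hδρ (hcont.intervalIntegrable _ _) hgi ?_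
        intro u hu
        have h1 : 1 ≤ u / δ := (one_le_div hδ).mpr hu.1
        have h2 := Real.exp_pos (-c * u ^ 2)
        nlinarith
    _ = -Real.exp (-c * ρ ^ 2) / (2 * c * δ) - -Real.exp (-c * δ ^ 2) / (2 * c * δ) :=
        intervalIntegral.integral_eq_sub_of_hasDerivAt hderiv hgi
    _ ≤ Real.exp (-c * δ ^ 2) / (2 * c * δ) := by
        have : 0 ≤ Real.exp (-c * ρ ^ 2) / (2 * c * δ) := by positivity
        rw [neg_div, neg_div]
        linarith

/-- The mirror-image Gaussian tail on `[−ρ, −δ]`. -/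
theorem integral_exp_neg_mul_sq_tail_le' {c δ ρ : ℝ} (hc : 0 < c) (hδ : 0 < δ) (hδρ : δ ≤ ρ) :
    ∫ u in (-ρ)..(-δ), Real.exp (-c * u ^ 2) ≤ Real.exp (-c * δ ^ 2) / (2 * c * δ) := by
  have h := intervalIntegral.integral_comp_neg (a := -ρ) (b := -δ)
    (f := fun u : ℝ => Real.exp (-c * u ^ 2))
  simp only [neg_neg, neg_sq] at h
  have h' : ∫ u in (-ρ)..(-δ), Real.exp (-c * u ^ 2) = ∫ u in δ..ρ, Real.exp (-c * u ^ 2) := by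
    simpa [neg_sq] using h
  rw [h']
  exact integral_exp_neg_mul_sq_tail_le hc hδ hδρ

/-- A Gaussian integral over any interval is at most its whole-line value `√(π/c)`. -/
theorem integral_exp_neg_mul_sq_le_sqrt {c a b : ℝ} (hc : 0 < c) (hab : a ≤ b) :
    ∫ u in a..b, Real.exp (-c * u ^ 2) ≤ Real.sqrt (Real.pi / c) := by
  rw [intervalIntegral.integral_of_le hab, ← integral_gaussian]
  exact setIntegral_le_integral (integrable_exp_neg_mul_sq hc)
    (Filter.Eventually.of_forall fun x => (Real.exp_pos _).le)

/-- Centre piece: for `0 ≤ q`, `q (1/n)² ≤ S` and `1/n ≤ δ`, `∫_{−δ}^{δ} e^{−q v²} dv ≥ 2 e^{−S}/n`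
(shrink to `|v| ≤ 1/n`, where the integrand is `≥ e^{−S}`). -/
theorem integral_exp_neg_mul_sq_centre_ge {q S n δ : ℝ} (hn : 0 < n) (hq : 0 ≤ q)
    (hqS : q * (1 / n) ^ 2 ≤ S) (hδ : 1 / n ≤ δ) :
    2 * Real.exp (-S) / n ≤ ∫ v in (-δ)..δ, Real.exp (-q * v ^ 2) := by
  have hn' : 0 < 1 / n := by positivity
  have hcont : Continuous fun v : ℝ => Real.exp (-q * v ^ 2) := by fun_prop
  calc 2 * Real.exp (-S) / n = ∫ _ in (-(1 / n))..(1 / n), Real.exp (-S) := by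
        rw [intervalIntegral.integral_const, smul_eq_mul]
        ring
    _ ≤ ∫ v in (-(1 / n))..(1 / n), Real.exp (-q * v ^ 2) := by
        refine intervalIntegral.integral_mono_on (by linarith) intervalIntegrable_const
          (hcont.intervalIntegrable _ _) ?_
        intro v hv
        have hv2 : v ^ 2 ≤ (1 / n) ^ 2 := sq_le_sq' hv.1 hv.2
        have := mul_le_mul_of_nonneg_left hv2 hq
        exact Real.exp_le_exp.mpr (by linarith)
    _ ≤ ∫ v in (-δ)..δ, Real.exp (-q * v ^ 2) :=
        intervalIntegral.integral_mono_interval (neg_le_neg hδ) (by linarith) hδ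
          (Filter.Eventually.of_forall fun x => (Real.exp_pos _).le)
          (hcont.intervalIntegrable _ _)

/-! ## §2 The real part of `exp z` for a small phase -/

/-- For `|Im z| ≤ 1`: `Re (exp z) ≥ ½ exp (Re z)`, since `cos y ≥ 1 − y²/2 ≥ ½` for `|y| ≤ 1`. -/
theorem half_exp_re_le_re_cexp {z : ℂ} (hz : |z.im| ≤ 1) :
    Real.exp z.re / 2 ≤ (Complex.exp z).re := by
  rw [Complex.exp_re]
  have h1 := Real.one_sub_sq_div_two_le_cos (x := z.im)
  have h2 : z.im ^ 2 ≤ 1 := by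
    have h := sq_le_sq' (abs_le.mp hz).1 (abs_le.mp hz).2
    simpa using h
  have h3 := Real.exp_pos z.re
  nlinarith

/-! ## §3 The abstract five-piece box estimate -/

/-- Five-piece box estimate.  Let `0 < δ ≤ ρ`, `0 < p`, and let `f : ℝ → ℝ → ℂ` be jointly continuous with
`‖f u v‖ ≤ e^{−p u²} e^{−p v²}` on the box `|u|, |v| ≤ ρ` and `Re f u v ≥ ½ e^{−q u²} e^{−q v²}` on the centre
square `|u|, |v| ≤ δ`.  Then, with `B = ∫_{−δ}^{δ} e^{−q v²} dv`, `E = e^{−p δ²}/(2 p δ)` (the Gaussian tail)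
and `J = √(π/p)` (the whole-line Gaussian),
`Re ∫_{−ρ}^{ρ} ∫_{−ρ}^{ρ} f ≥ B²/2 − 4 δ E − 2 J E`:
the centre square contributes `≥ B²/2`, the two inner side strips `|u| ≤ δ < |v|` at most `4 δ E` in modulus,
the two outer strips `|u| > δ` at most `2 J E`. -/
theorem re_box_integral_ge {ρ δ p q : ℝ} (hδ : 0 < δ) (hδρ : δ ≤ ρ) (hp : 0 < p)
    (f : ℝ → ℝ → ℂ) (hf : Continuous (Function.uncurry f))
    (h1 : ∀ u v, |u| ≤ ρ → |v| ≤ ρ → ‖f u v‖ ≤ Real.exp (-p * u ^ 2) * Real.exp (-p * v ^ 2))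
    (h2 : ∀ u v, |u| ≤ δ → |v| ≤ δ →
      Real.exp (-q * u ^ 2) * Real.exp (-q * v ^ 2) / 2 ≤ (f u v).re) :
    (∫ v in (-δ)..δ, Real.exp (-q * v ^ 2)) ^ 2 / 2
        - 4 * δ * (Real.exp (-p * δ ^ 2) / (2 * p * δ))
        - 2 * Real.sqrt (Real.pi / p) * (Real.exp (-p * δ ^ 2) / (2 * p * δ))
      ≤ (∫ u in (-ρ)..ρ, ∫ v in (-ρ)..ρ, f u v).re := by
  have hρ : 0 < ρ := hδ.trans_le hδρ
  generalize hE : Real.exp (-p * δ ^ 2) / (2 * p * δ) = E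
  generalize hJ : Real.sqrt (Real.pi / p) = J
  generalize hB : (∫ v in (-δ)..δ, Real.exp (-q * v ^ 2)) = B
  have hJ0 : 0 ≤ J := hJ ▸ Real.sqrt_nonneg _
  -- continuity and integrability
  have hfu : ∀ u, Continuous (f u) := fun u => hf.uncurry_left u
  have hfi : ∀ u a b, IntervalIntegrable (f u) volume a b := fun u a b =>
    (hfu u).intervalIntegrable a b
  have hI : Continuous fun u => ∫ v in (-ρ)..ρ, f u v :=
    intervalIntegral.continuous_parametric_intervalIntegral_of_continuous' hf (-ρ) ρ
  have hIi : ∀ a b, IntervalIntegrable (fun u => ∫ v in (-ρ)..ρ, f u v) volume a b := fun a b =>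
    hI.intervalIntegrable a b
  have hgi : ∀ (c a b : ℝ), IntervalIntegrable (fun x : ℝ => Real.exp (-c * x ^ 2)) volume a b :=
    fun c a b => (by fun_prop : Continuous fun x : ℝ => Real.exp (-c * x ^ 2)).intervalIntegrable a b
  -- (i) modulus of the inner integral on the whole box
  have hIn : ∀ u, |u| ≤ ρ → ‖∫ v in (-ρ)..ρ, f u v‖ ≤ Real.exp (-p * u ^ 2) * J := by
    intro u hu
    calc ‖∫ v in (-ρ)..ρ, f u v‖ ≤ ∫ v in (-ρ)..ρ, ‖f u v‖ :=
          intervalIntegral.norm_integral_le_integral_norm (by linarith)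
      _ ≤ ∫ v in (-ρ)..ρ, Real.exp (-p * u ^ 2) * Real.exp (-p * v ^ 2) := by
          refine intervalIntegral.integral_mono_on (by linarith) ((hfi u _ _).norm)
            ((hgi p _ _).const_mul _) ?_
          intro v hv
          exact h1 u v hu (abs_le.mpr ⟨hv.1, hv.2⟩)
      _ = Real.exp (-p * u ^ 2) * ∫ v in (-ρ)..ρ, Real.exp (-p * v ^ 2) :=
          intervalIntegral.integral_const_mul _ _
      _ ≤ Real.exp (-p * u ^ 2) * J :=
          mul_le_mul_of_nonneg_left ((integral_exp_neg_mul_sq_le_sqrt hp (by linarith)).trans_eq hJ)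
            (Real.exp_pos _).le
  -- (ii) the two outer strips
  have hT2 : ‖∫ u in δ..ρ, ∫ v in (-ρ)..ρ, f u v‖ ≤ J * E := by
    calc ‖∫ u in δ..ρ, ∫ v in (-ρ)..ρ, f u v‖ ≤ ∫ u in δ..ρ, ‖∫ v in (-ρ)..ρ, f u v‖ :=
          intervalIntegral.norm_integral_le_integral_norm hδρ
      _ ≤ ∫ u in δ..ρ, Real.exp (-p * u ^ 2) * J := by
          refine intervalIntegral.integral_mono_on hδρ ((hIi _ _).norm) ((hgi p _ _).mul_const _) ?_
          intro u hu
          exact hIn u (abs_le.mpr ⟨by linarith [hu.1], hu.2⟩)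
      _ = (∫ u in δ..ρ, Real.exp (-p * u ^ 2)) * J := intervalIntegral.integral_mul_const _ _
      _ ≤ E * J := mul_le_mul_of_nonneg_right
          ((integral_exp_neg_mul_sq_tail_le hp hδ hδρ).trans_eq hE) hJ0
      _ = J * E := mul_comm _ _
  have hT1 : ‖∫ u in (-ρ)..(-δ), ∫ v in (-ρ)..ρ, f u v‖ ≤ J * E := by
    calc ‖∫ u in (-ρ)..(-δ), ∫ v in (-ρ)..ρ, f u v‖
        ≤ ∫ u in (-ρ)..(-δ), ‖∫ v in (-ρ)..ρ, f u v‖ :=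
          intervalIntegral.norm_integral_le_integral_norm (by linarith)
      _ ≤ ∫ u in (-ρ)..(-δ), Real.exp (-p * u ^ 2) * J := by
          refine intervalIntegral.integral_mono_on (by linarith) ((hIi _ _).norm)
            ((hgi p _ _).mul_const _) ?_
          intro u hu
          exact hIn u (abs_le.mpr ⟨hu.1, by linarith [hu.2]⟩)
      _ = (∫ u in (-ρ)..(-δ), Real.exp (-p * u ^ 2)) * J := intervalIntegral.integral_mul_const _ _
      _ ≤ E * J := mul_le_mul_of_nonneg_right
          ((integral_exp_neg_mul_sq_tail_le' hp hδ hδρ).trans_eq hE) hJ0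
      _ = J * E := mul_comm _ _
  -- (iii) the middle slices `|u| ≤ δ`
  have hmid : ∀ u, |u| ≤ δ →
      Real.exp (-q * u ^ 2) * B / 2 - 2 * E ≤ (∫ v in (-ρ)..ρ, f u v).re := by
    intro u hu
    have huρ : |u| ≤ ρ := hu.trans hδρ
    have hpu : Real.exp (-p * u ^ 2) ≤ 1 := Real.exp_le_one_iff.mpr (by nlinarith [sq_nonneg u])
    have htail : ∀ v, |v| ≤ ρ → ‖f u v‖ ≤ Real.exp (-p * v ^ 2) := fun v hv =>
      (h1 u v huρ hv).trans (mul_le_of_le_one_left (Real.exp_pos _).le hpu)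
    have ht3 : ‖∫ v in δ..ρ, f u v‖ ≤ E := by
      calc ‖∫ v in δ..ρ, f u v‖ ≤ ∫ v in δ..ρ, ‖f u v‖ :=
            intervalIntegral.norm_integral_le_integral_norm hδρ
        _ ≤ ∫ v in δ..ρ, Real.exp (-p * v ^ 2) := by
            refine intervalIntegral.integral_mono_on hδρ ((hfi u _ _).norm) (hgi p _ _) ?_
            intro v hv
            exact htail v (abs_le.mpr ⟨by linarith [hv.1], hv.2⟩)
        _ ≤ E := (integral_exp_neg_mul_sq_tail_le hp hδ hδρ).trans_eq hE
    have ht1 : ‖∫ v in (-ρ)..(-δ), f u v‖ ≤ E := by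
      calc ‖∫ v in (-ρ)..(-δ), f u v‖ ≤ ∫ v in (-ρ)..(-δ), ‖f u v‖ :=
            intervalIntegral.norm_integral_le_integral_norm (by linarith)
        _ ≤ ∫ v in (-ρ)..(-δ), Real.exp (-p * v ^ 2) := by
            refine intervalIntegral.integral_mono_on (by linarith) ((hfi u _ _).norm) (hgi p _ _) ?_
            intro v hv
            exact htail v (abs_le.mpr ⟨hv.1, by linarith [hv.2]⟩)
        _ ≤ E := (integral_exp_neg_mul_sq_tail_le' hp hδ hδρ).trans_eq hE
    have hc : Real.exp (-q * u ^ 2) * B / 2 ≤ (∫ v in (-δ)..δ, f u v).re := by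
      have hre : (∫ v in (-δ)..δ, f u v).re = ∫ v in (-δ)..δ, (f u v).re := by
        have h := Complex.reCLM.intervalIntegral_comp_comm (hfi u (-δ) δ)
        simpa using h.symm
      rw [hre]
      calc Real.exp (-q * u ^ 2) * B / 2
          = ∫ v in (-δ)..δ, Real.exp (-q * u ^ 2) * Real.exp (-q * v ^ 2) / 2 := by
            rw [intervalIntegral.integral_div, intervalIntegral.integral_const_mul, hB]
        _ ≤ ∫ v in (-δ)..δ, (f u v).re := by
            refine intervalIntegral.integral_mono_on (by linarith)
              (((hgi q _ _).const_mul _).div_const _)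
              ((Complex.continuous_re.comp (hfu u)).intervalIntegrable _ _) ?_
            intro v hv
            exact h2 u v hu (abs_le.mpr ⟨hv.1, hv.2⟩)
    have hsplit : ∫ v in (-ρ)..ρ, f u v
        = ((∫ v in (-ρ)..(-δ), f u v) + ∫ v in (-δ)..δ, f u v) + ∫ v in δ..ρ, f u v := by
      rw [intervalIntegral.integral_add_adjacent_intervals (hfi u (-ρ) (-δ)) (hfi u (-δ) δ),
        intervalIntegral.integral_add_adjacent_intervals (hfi u (-ρ) δ) (hfi u δ ρ)]
    have r1 := abs_le.mp ((Complex.abs_re_le_norm _).trans ht1)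
    have r3 := abs_le.mp ((Complex.abs_re_le_norm _).trans ht3)
    rw [hsplit, Complex.add_re, Complex.add_re]
    linarith [r1.1, r3.1]
  -- (iv) the middle block `|u| ≤ δ`, integrated
  have hMid : B ^ 2 / 2 - 4 * δ * E ≤ (∫ u in (-δ)..δ, ∫ v in (-ρ)..ρ, f u v).re := by
    have hre : (∫ u in (-δ)..δ, ∫ v in (-ρ)..ρ, f u v).re
        = ∫ u in (-δ)..δ, (∫ v in (-ρ)..ρ, f u v).re := by
      have h := Complex.reCLM.intervalIntegral_comp_comm (hIi (-δ) δ)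
      simpa using h.symm
    rw [hre]
    have hli : IntervalIntegrable (fun u : ℝ => Real.exp (-q * u ^ 2) * B / 2) volume (-δ) δ :=
      ((hgi q _ _).mul_const _).div_const _
    calc B ^ 2 / 2 - 4 * δ * E = ∫ u in (-δ)..δ, (Real.exp (-q * u ^ 2) * B / 2 - 2 * E) := by
          rw [intervalIntegral.integral_sub hli intervalIntegrable_const,
            intervalIntegral.integral_const, intervalIntegral.integral_div,
            intervalIntegral.integral_mul_const, hB, smul_eq_mul]
          ring
      _ ≤ ∫ u in (-δ)..δ, (∫ v in (-ρ)..ρ, f u v).re := by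
          refine intervalIntegral.integral_mono_on (by linarith) (hli.sub intervalIntegrable_const)
            ((Complex.continuous_re.comp hI).intervalIntegrable _ _) ?_
          intro u hu
          exact hmid u (abs_le.mpr ⟨hu.1, hu.2⟩)
  -- (v) assemble
  have hsplit : ∫ u in (-ρ)..ρ, ∫ v in (-ρ)..ρ, f u v
      = ((∫ u in (-ρ)..(-δ), ∫ v in (-ρ)..ρ, f u v) + ∫ u in (-δ)..δ, ∫ v in (-ρ)..ρ, f u v)
        + ∫ u in δ..ρ, ∫ v in (-ρ)..ρ, f u v := by
    rw [intervalIntegral.integral_add_adjacent_intervals (hIi (-ρ) (-δ)) (hIi (-δ) δ),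
      intervalIntegral.integral_add_adjacent_intervals (hIi (-ρ) δ) (hIi δ ρ)]
  have r1 := abs_le.mp ((Complex.abs_re_le_norm _).trans hT1)
  have r2 := abs_le.mp ((Complex.abs_re_le_norm _).trans hT2)
  rw [hsplit, Complex.add_re, Complex.add_re]
  linarith [r1.1, r2.1]

end Summit.Ventures.CertifiedManyBodySolver.Theorems.TcThermcert1.ZeroFreeCorridor

end
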